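import Summits.BirchSwinnertonDyer.BirchSwinnertonDyer.Theorems.ManinLocalTwoThreeShimuraQuotientFourP
import Summits.BirchSwinnertonDyer.BirchSwinnertonDyer.Theorems.ManinLocalTwoThreeThirdLattice
import Literature.NumberTheory.EllipticCurves.LatticeIndexTwoHalfPeriodProofs
import Literature.NumberTheory.EllipticCurves.WeierstrassPMultiplication
import HarnessLib

/-!
# The `3`-adic Γ₀/Γ₁ twin: at `9 ∣ N` a non-homothetic Shimura cover produces a RATIONAL `3`-ISOGENY; so at `N = 9p`,
# `p ≡ 2 (mod 3)`, an optimal curve without rational `3`-isogeny IS Stevens' curve: `Λ₁(f) = Λ₀(f)`, `|c₀| = |c₁|`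

Summit `BirchSwinnertonDyer`, route `ManinLocalTwoThree` (cell bsd-f2-manin), crux C3 `ManinPrimeToThreeAtNine`
(stmt-BirchSwinnertonDyer-22968): the `3`-adic twin of `…ShimuraRationalTwoTorsion` (p635211).  For the optimal `X₁(N)`/`X₀(N)`
pair `(D₁, D₀)` of a class at `9 ∣ N` the ledger gives `c₁ ∣ c₀ ∣ 3c₁` (p629489) and Ling–Oesterlé `3Λ₀(f) ⊆ Λ₁(f) ⊆ Λ₀(f)`
(`a₃(f) = 0`); the third-lattice trichotomy (p637134) on `Λ_{E₀} ⊆ ⅓Λ_{E₁}` (untripled) resp. `Λ_{E₀} ⊆ Λ_{E₁}` (tripled),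
the rationality of an index-`3` kernel abscissa (`PeriodPair.exists_ratCast_eq_weierstrassP_of_index_three`, p636272) and the
division-polynomial dictionary `Ψ₃(℘(z₀)) = 0 ⟺ 3z₀ ∈ Λ` (`PeriodPair.eval_ΨSq_weierstrassP_eq_zero_iff`) give:

* `exists_Ψ₃_root_of_index_three` — an index-`3` superlattice of the Néron lattice with rational invariants yields a
  RATIONAL ROOT of Mathlib's `3`-division polynomial `W₀.Ψ₃` (a rational `3`-isogeny; any model `W₀`, via the covariance
  `Ψ₃^{W}(x − b₂/12) = Ψ₃^{W_sh}(x)`, `W_sh = [0,0,0,−c₄/48,−c₆/864]`);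
* `trichotomy_shimura_of_nine_dvd_level` — `Λ₁(f) = Λ₀(f)` (index `1`), or `Λ₁(f) = 3Λ₀(f)` (index `9`), or `W₀.Ψ₃` has
  a rational root (index `3`);
* `not_periodLatticeGamma1_eq_three_mul_of_nine_mul[_prime]` — at `N = 9q` (`3 ∤ q`, `(ℤ/q)ˣ` cyclic of order prime to
  `3`; `N = 9p`, `p ≡ 2 (mod 3)`) index `9` is impossible (the Shimura quotient is `0` or `ℤ/3`, p636907, but `Λ₀/3Λ₀ ≅ (ℤ/3)²`);
* `stevens_eq_optimal_of_noRationalThreeIsogeny_nine_mul[_prime]` — **at such levels, `W₀.Ψ₃` without rational root ⟹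
  `Λ₁(f) = Λ₀(f)` and `|c₀| = |c₁|`**, whence `3 ∤ c₀ ⟺ 3 ∤ c₁`: C3 for `D₀` is exactly «`3 ∤ c₁`» for Stevens' datum.

HONEST FRAMING: structure only; C3, Manin's conjecture and BSD are not proved.  No definitions.
-/

set_option autoImplicit false
-- the summit-side namespace `Summit.BirchSwinnertonDyer.BirchSwinnertonDyer.…` is the tree's (summit = sub-problem)
set_option linter.dupNamespace false

noncomputable section

open WeierstrassCurve Literature.NumberTheory.EllipticCurves Literature.NumberTheory.EllipticCurves.ModularForms
open CongruenceSubgroup Polynomial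

namespace Summit.BirchSwinnertonDyer.BirchSwinnertonDyer.Theorems.ManinLocalTwoThree

variable {W₁ W₀ : WeierstrassCurve ℚ} [W₁.IsElliptic] [W₁.IsGloballyMinimal] [W₀.IsElliptic]
  [W₀.IsGloballyMinimal] {N : ℕ} [NeZero N]

/-! ### From an index-`3` superlattice to a rational root of `Ψ₃` -/

/-- **Covariance of `Ψ₃` under completing the square and the cube** (`u = 1`, `r = −b₂/12`): for any model `W/ℚ`,
`Ψ₃^{W}(x − b₂/12) = Ψ₃^{W_sh}(x)` with `W_sh = [0, 0, 0, −c₄/48, −c₆/864]` — a polynomial identity. -/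
theorem Ψ₃_eval_sub_b₂_div_twelve (W : WeierstrassCurve ℚ) (x : ℚ) :
    W.Ψ₃.eval (x - W.b₂ / 12) = (⟨0, 0, 0, -W.c₄ / 48, -W.c₆ / 864⟩ : WeierstrassCurve ℚ).Ψ₃.eval x := by
  simp only [WeierstrassCurve.Ψ₃, WeierstrassCurve.b₂, WeierstrassCurve.b₄, WeierstrassCurve.b₆, WeierstrassCurve.b₈,
    WeierstrassCurve.c₄, WeierstrassCurve.c₆, eval_add, eval_mul, eval_pow, eval_C, eval_X, eval_ofNat]
  ring

omit [W₀.IsElliptic] [W₀.IsGloballyMinimal] in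
/-- **An index-`3` superlattice with rational invariants yields a rational `3`-isogeny.**  `W₀/ℚ` any model with Néron-type
pair `L₀` (`g₂ = c₄/12`, `g₃ = c₆/216`); `L'` a period pair with rational `g₂, g₃`, `Λ₀ ⊆ Λ' ⊆ Λ₀ ∪ (±z₀ + Λ₀)` with
`z₀ ∈ Λ' ∖ Λ₀`, `3z₀ ∈ Λ₀`: then `℘_{Λ₀}(z₀) ∈ ℚ` (p636272) is a root of `Ψ₃` of `E_{Λ₀}`, i.e. `℘_{Λ₀}(z₀) − b₂/12` is a
rational root of `W₀.Ψ₃` — the kernel `{O, ±T}` of the `3`-isogeny `ℂ/Λ₀ → ℂ/Λ'` is defined over `ℚ`. -/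
theorem exists_Ψ₃_root_of_index_three {L₀ : PeriodPair} (hL₀ : IsNeronLatticeOf (W₀.baseChange ℂ) L₀) (L' : PeriodPair)
    (h₂' : ∃ r : ℚ, (r : ℂ) = L'.g₂) (h₃' : ∃ r : ℚ, (r : ℂ) = L'.g₃) (hle : L₀.lattice ≤ L'.lattice)
    {z₀ : ℂ} (hz₀' : z₀ ∈ L'.lattice) (hz₀ : z₀ ∉ L₀.lattice) (h3 : 3 * z₀ ∈ L₀.lattice)
    (hidx : ∀ w ∈ L'.lattice, w ∈ L₀.lattice ∨ w - z₀ ∈ L₀.lattice ∨ w + z₀ ∈ L₀.lattice) :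
    ∃ x : ℚ, W₀.Ψ₃.eval x = 0 := by
  have hc₄ : (W₀.baseChange ℂ).c₄ = (W₀.c₄ : ℂ) := by simp [WeierstrassCurve.baseChange, WeierstrassCurve.map_c₄]
  have hc₆ : (W₀.baseChange ℂ).c₆ = (W₀.c₆ : ℂ) := by simp [WeierstrassCurve.baseChange, WeierstrassCurve.map_c₆]
  have hg₂ : L₀.g₂ = ((W₀.c₄ / 12 : ℚ) : ℂ) := by rw [hL₀.1, hc₄]; push_cast; ring
  have hg₃ : L₀.g₃ = ((W₀.c₆ / 216 : ℚ) : ℂ) := by rw [hL₀.2, hc₆]; push_cast; ring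
  obtain ⟨q, hq⟩ := L₀.exists_ratCast_eq_weierstrassP_of_index_three L' hle ⟨_, hg₂.symm⟩ ⟨_, hg₃.symm⟩
    h₂' h₃' hz₀' hz₀ hidx
  -- `Ψ₃` of `E_{Λ₀}` vanishes at `℘(z₀)` since `3z₀ ∈ Λ₀`
  have hΨsq : (L₀.curve.ΨSq 3).eval (L₀.weierstrassP z₀) = 0 :=
    (L₀.eval_ΨSq_weierstrassP_eq_zero_iff hz₀ 3).mpr (by exact_mod_cast h3)
  -- the short rational model of `E_{Λ₀}`
  set E : WeierstrassCurve ℚ := ⟨0, 0, 0, -W₀.c₄ / 48, -W₀.c₆ / 864⟩ with hE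
  have hEmap : E.map (algebraMap ℚ ℂ) = L₀.curve := by
    refine PeriodPair.map_eq_curve ?_ ?_
    · rw [hg₂, eq_ratCast]; push_cast; ring
    · rw [hg₃, eq_ratCast]; push_cast; ring
  have hEΨ : aeval (L₀.weierstrassP z₀) (E.ΨSq 3) = 0 := by
    rw [PeriodPair.aeval_ΨSq_of_map_eq_curve hEmap]; exact hΨsq
  rw [WeierstrassCurve.ΨSq_three, map_pow, ← hq] at hEΨ
  have hEΨ₃ : aeval (q : ℂ) E.Ψ₃ = 0 := pow_eq_zero_iff (two_ne_zero) |>.mp hEΨ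
  have hq' : (q : ℂ) = algebraMap ℚ ℂ q := (eq_ratCast _ q).symm
  rw [hq', aeval_algebraMap_apply_eq_algebraMap_eval] at hEΨ₃
  have hroot : E.Ψ₃.eval q = 0 := by
    have h := hEΨ₃
    rw [eq_ratCast] at h
    exact_mod_cast h
  exact ⟨q - W₀.b₂ / 12, by rw [Ψ₃_eval_sub_b₂_div_twelve, ← hE]; exact hroot⟩

/-! ### The Shimura trichotomy at `9 ∣ N` -/

/-- **Shimura trichotomy for the optimal pair at `9 ∣ N`.**  For the optimal `X₁(N)`-datum `D₁` and the optimal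
`X₀(N)`-datum `D₀` of a class (globally minimal models, any shape): `Λ₁(f) = Λ₀(f)`, or `Λ₁(f) = 3Λ₀(f)`, or `W₀.Ψ₃` has a
rational root (a rational `3`-isogeny).  (Untripled `|c₀| = |c₁|`: third-lattice trichotomy on `Λ_{E₀} ⊆ ⅓Λ_{E₁}`;
tripled `|c₀| = 3|c₁|`: on `Λ_{E₀} ⊆ Λ_{E₁}`; the index-`3` cases give a rational kernel abscissa.) -/
theorem trichotomy_shimura_of_nine_dvd_level (D₁ : Gamma1ParametrizationData W₁ N)
    (D₀ : ModularParametrizationData W₀ N) (hiso : IsIsogenous W₁ W₀) (h₁ : D₁.IsOptimal)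
    (h₀ : ∀ z ∈ D₀.L.lattice, ∃ w ∈ periodLattice D₀.f, z = D₀.c * w) (h9 : 3 ^ 2 ∣ N) :
    periodLatticeGamma1 D₀.f = periodLattice D₀.f ∨
      (∀ z : ℂ, z ∈ periodLatticeGamma1 D₀.f ↔ ∃ w ∈ periodLattice D₀.f, z = 3 * w) ∨
      ∃ x : ℚ, W₀.Ψ₃.eval x = 0 := by
  have hf : D₁.f = D₀.f := D₁.f_eq_of_isIsogenous D₀ hiso
  have hc₁ : (D₁.c : ℂ) ≠ 0 := by exact_mod_cast D₁.maninConstant_ne_zero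
  have hc₄W₁ : (W₁.baseChange ℂ).c₄ = (W₁.c₄ : ℂ) := by simp [WeierstrassCurve.baseChange, WeierstrassCurve.map_c₄]
  have hc₆W₁ : (W₁.baseChange ℂ).c₆ = (W₁.c₆ : ℂ) := by simp [WeierstrassCurve.baseChange, WeierstrassCurve.map_c₆]
  have hg₂₁ : ∃ r : ℚ, (r : ℂ) = D₁.L.g₂ := ⟨W₁.c₄ / 12, by rw [D₁.isNeronLattice.1, hc₄W₁]; push_cast; ring⟩
  have hg₃₁ : ∃ r : ℚ, (r : ℂ) = D₁.L.g₃ := ⟨W₁.c₆ / 216, by rw [D₁.isNeronLattice.2, hc₆W₁]; push_cast; ring⟩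
  -- Ling–Oesterlé at `3`
  have h3Λ : ∀ w ∈ periodLattice D₀.f, (3 : ℂ) * w ∈ periodLatticeGamma1 D₀.f := fun w hw ↦ by
    have h := pMulLatticeLeGamma1OfTracelessPrime_holds N D₀.f D₀.isNewformOf.1 3 Nat.prime_three
      ((dvd_pow_self 3 two_ne_zero).trans h9) (D₀.isNewformOf.1.cuspCoeff_eq_zero_of_sq_dvd Nat.prime_three h9) w hw
    exact_mod_cast h
  have out1 : (∀ w ∈ periodLattice D₀.f, w ∈ periodLatticeGamma1 D₀.f) →
      periodLatticeGamma1 D₀.f = periodLattice D₀.f :=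
    fun h ↦ le_antisymm (periodLatticeGamma1_le_periodLattice D₀.f) h
  have out9 : (∀ z ∈ periodLatticeGamma1 D₀.f, ∃ w ∈ periodLattice D₀.f, z = 3 * w) →
      ∀ z : ℂ, z ∈ periodLatticeGamma1 D₀.f ↔ ∃ w ∈ periodLattice D₀.f, z = 3 * w :=
    fun h z ↦ ⟨h z, by rintro ⟨w, hw, rfl⟩; exact h3Λ w hw⟩
  rcases natAbs_maninConstant₀_eq_or_eq_three_mul_of_nine_dvd_level D₁ D₀ hiso h₁ h₀ h9 with habs | habs
  · -- untripled: `Λ_{E₀} ⊆ ⅓Λ_{E₁}` with `3 · ⅓Λ_{E₁} ⊆ Λ_{E₀}`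
    obtain ⟨ε, hε, hcc⟩ : ∃ ε : ℂ, (ε = 1 ∨ ε = -1) ∧ (D₀.c : ℂ) = ε * D₁.c := by
      rcases Int.natAbs_eq_natAbs_iff.mp habs with h' | h'
      · exact ⟨1, Or.inl rfl, by rw [one_mul]; exact_mod_cast h'⟩
      · exact ⟨-1, Or.inr rfl, by rw [neg_one_mul]; exact_mod_cast h'⟩
    have hε2 : ε * ε = 1 := by rcases hε with rfl | rfl <;> norm_num
    have hεmem : ∀ (S : AddSubgroup ℂ) (w : ℂ), w ∈ S → ε * w ∈ S := by
      intro S w hw; rcases hε with rfl | rfl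
      · rwa [one_mul]
      · rw [neg_one_mul]; exact neg_mem hw
    set H : PeriodPair := D₁.L.mulLeft ((3 : ℂ)⁻¹) (inv_ne_zero three_ne_zero) with hH
    have hHmem : ∀ z, z ∈ H.lattice ↔ 3 * z ∈ D₁.L.lattice := fun z ↦ by
      rw [hH, PeriodPair.mem_mulLeft_lattice, inv_inv]
    have hle : D₀.L.lattice ≤ H.lattice := by
      intro z hz
      obtain ⟨w, hw, rfl⟩ := h₀ z hz
      rw [hHmem]
      have e : 3 * ((D₀.c : ℂ) * w) = (D₁.c : ℂ) * (ε * (3 * w)) := by rw [hcc]; ring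
      rw [e]
      exact D₁.smul_periodLatticeGamma1_le _ (hεmem _ _ (by rw [hf]; exact h3Λ w hw))
    have hthree : ∀ w ∈ H.lattice, 3 * w ∈ D₀.L.lattice := by
      intro w hw
      rw [hHmem] at hw
      obtain ⟨w₁, hw₁, hw₁'⟩ := h₁ _ hw
      have hw₀ : ε * w₁ ∈ periodLattice D₀.f := hεmem _ _ (hf ▸ periodLatticeGamma1_le_periodLattice D₁.f hw₁)
      have e : 3 * w = (D₀.c : ℂ) * (ε * w₁) := by
        rw [hw₁', hcc]; linear_combination -((D₁.c : ℂ) * w₁) * hε2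
      rw [e]; exact D₀.smul_periodLattice_le _ hw₀
    rcases thirdLattice_trichotomy D₀.L H hle hthree with hcase | hcase | hcase
    · -- `⅓Λ_{E₁} ⊆ Λ_{E₀}`: `Λ₁ ⊆ 3Λ₀`, index 9
      right; left
      refine out9 fun z hz ↦ ?_
      have hzH : (D₁.c : ℂ) * z * 3⁻¹ ∈ H.lattice := by
        rw [hHmem, show 3 * ((D₁.c : ℂ) * z * 3⁻¹) = (D₁.c : ℂ) * z by ring]
        exact D₁.smul_periodLatticeGamma1_le z (hf ▸ hz)
      obtain ⟨w, hw, hw'⟩ := h₀ _ (hcase _ hzH)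
      refine ⟨ε * w, hεmem _ _ hw, ?_⟩
      have h : (D₁.c : ℂ) * z = (D₁.c : ℂ) * (3 * (ε * w)) := by
        rw [show (D₁.c : ℂ) * z = 3 * ((D₁.c : ℂ) * z * 3⁻¹) by ring, hw', hcc]; ring
      exact mul_left_cancel₀ hc₁ h
    · -- `⅓Λ_{E₀} ⊆ ⅓Λ_{E₁}`: `Λ₀ ⊆ Λ₁`
      left
      refine out1 fun w hw ↦ ?_
      have h3h : 3 * ((D₀.c : ℂ) * w * 3⁻¹) ∈ D₀.L.lattice := by
        rw [show 3 * ((D₀.c : ℂ) * w * 3⁻¹) = (D₀.c : ℂ) * w by ring]; exact D₀.smul_periodLattice_le w hw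
      have hH' := hcase _ h3h
      rw [hHmem, show 3 * ((D₀.c : ℂ) * w * 3⁻¹) = (D₀.c : ℂ) * w by ring] at hH'
      obtain ⟨w₁, hw₁, hw₁'⟩ := h₁ _ hH'
      have hw' : w = ε * w₁ := by
        have h : (D₁.c : ℂ) * w = (D₁.c : ℂ) * (ε * w₁) := by
          rw [hcc] at hw₁'
          linear_combination ε * hw₁' - ((D₁.c : ℂ) * w) * hε2
        exact mul_left_cancel₀ hc₁ h
      rw [hw', ← hf]; exact hεmem _ _ hw₁
    · -- index 3: rational `3`-isogeny of `E₀`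
      right; right
      obtain ⟨z₀, hz₀', hz₀, hidx⟩ := hcase
      refine exists_Ψ₃_root_of_index_three D₀.isNeronLattice H ?_ ?_ hle hz₀' hz₀ (hthree z₀ hz₀') hidx
      · obtain ⟨r, hr⟩ := hg₂₁
        exact ⟨3 ^ 4 * r, by rw [hH, PeriodPair.g₂_mulLeft, ← hr]; push_cast; ring⟩
      · obtain ⟨r, hr⟩ := hg₃₁
        exact ⟨3 ^ 6 * r, by rw [hH, PeriodPair.g₃_mulLeft, ← hr]; push_cast; ring⟩
  · -- tripled: `Λ_{E₀} ⊆ Λ_{E₁}` with `3Λ_{E₁} ⊆ Λ_{E₀}`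
    obtain ⟨ε, hε, hcc⟩ : ∃ ε : ℂ, (ε = 1 ∨ ε = -1) ∧ (D₀.c : ℂ) = ε * (3 * D₁.c) := by
      have h : D₀.maninConstant.natAbs = (3 * D₁.maninConstant).natAbs := by rw [habs, Int.natAbs_mul]; rfl
      rcases Int.natAbs_eq_natAbs_iff.mp h with h' | h'
      · exact ⟨1, Or.inl rfl, by rw [one_mul]; exact_mod_cast h'⟩
      · exact ⟨-1, Or.inr rfl, by rw [neg_one_mul]; exact_mod_cast h'⟩
    have hε2 : ε * ε = 1 := by rcases hε with rfl | rfl <;> norm_num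
    have hεmem : ∀ (S : AddSubgroup ℂ) (w : ℂ), w ∈ S → ε * w ∈ S := by
      intro S w hw; rcases hε with rfl | rfl
      · rwa [one_mul]
      · rw [neg_one_mul]; exact neg_mem hw
    have hle : D₀.L.lattice ≤ D₁.L.lattice := by
      intro z hz
      obtain ⟨w, hw, rfl⟩ := h₀ z hz
      have e : (D₀.c : ℂ) * w = (D₁.c : ℂ) * (ε * (3 * w)) := by rw [hcc]; ring
      rw [e]
      exact D₁.smul_periodLatticeGamma1_le _ (hεmem _ _ (by rw [hf]; exact h3Λ w hw))
    have hthree : ∀ w ∈ D₁.L.lattice, 3 * w ∈ D₀.L.lattice := by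
      intro w hw
      obtain ⟨w₁, hw₁, rfl⟩ := h₁ w hw
      have hw₀ : ε * w₁ ∈ periodLattice D₀.f := hεmem _ _ (hf ▸ periodLatticeGamma1_le_periodLattice D₁.f hw₁)
      have e : 3 * ((D₁.c : ℂ) * w₁) = (D₀.c : ℂ) * (ε * w₁) := by
        rw [hcc]; linear_combination -(3 * (D₁.c : ℂ) * w₁) * hε2
      rw [e]; exact D₀.smul_periodLattice_le _ hw₀
    rcases thirdLattice_trichotomy D₀.L D₁.L hle hthree with hcase | hcase | hcase
    · -- `Λ_{E₁} = Λ_{E₀}`: index 9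
      right; left
      refine out9 fun z hz ↦ ?_
      have hz' : (D₁.c : ℂ) * z ∈ D₀.L.lattice := hcase _ (D₁.smul_periodLatticeGamma1_le z (hf ▸ hz))
      obtain ⟨w, hw, hw'⟩ := h₀ _ hz'
      refine ⟨ε * w, hεmem _ _ hw, ?_⟩
      have h : (D₁.c : ℂ) * z = (D₁.c : ℂ) * (3 * (ε * w)) := by rw [hw', hcc]; ring
      exact mul_left_cancel₀ hc₁ h
    · -- `Λ_{E₁} ⊇ ⅓Λ_{E₀}`: `Λ₁ = Λ₀`
      left
      refine out1 fun w hw ↦ ?_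
      have h3h : 3 * (ε * ((D₁.c : ℂ) * w)) ∈ D₀.L.lattice := by
        have e : 3 * (ε * ((D₁.c : ℂ) * w)) = (D₀.c : ℂ) * w := by rw [hcc]; ring
        rw [e]; exact D₀.smul_periodLattice_le w hw
      obtain ⟨w₁, hw₁, hw₁'⟩ := h₁ _ (hcase _ h3h)
      have hw' : w = ε * w₁ := by
        have h : (D₁.c : ℂ) * w = (D₁.c : ℂ) * (ε * w₁) := by
          linear_combination ε * hw₁' - ((D₁.c : ℂ) * w) * hε2
        exact mul_left_cancel₀ hc₁ h
      rw [hw', ← hf]; exact hεmem _ _ hw₁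
    · -- index 3: rational `3`-isogeny of `E₀`
      right; right
      obtain ⟨z₀, hz₀', hz₀, hidx⟩ := hcase
      exact exists_Ψ₃_root_of_index_three D₀.isNeronLattice D₁.L hg₂₁ hg₃₁ hle hz₀' hz₀ (hthree z₀ hz₀') hidx

/-! ### No index `9` at `N = 9q`; Stevens' curve = the optimal curve without rational `3`-isogeny -/

omit [W₀.IsElliptic] [W₀.IsGloballyMinimal] [NeZero N] in
/-- **At `N = 9q` (`3 ∤ q`, `(ℤ/q)ˣ` cyclic of order prime to `3`) the index-`9` configuration `Λ₁(f) = 3Λ₀(f)` is impossible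
for a lattice-optimal `X₀(N)`-datum**: the Shimura quotient has at most the three classes `0, ±{∞, γ₀∞}_f`
(`exists_forall_mem_or_sub_mem_or_add_mem_periodLatticeGamma1_nine_mul_of_isNewform0`), but `ω₁/c₀, ω₂/c₀ ∈ Λ₀` would then put
one of the third-periods `ω₁/3`, `ω₂/3`, `(ω₁ ± ω₂)/3` in `Λ_{E₀}`. -/
theorem not_periodLatticeGamma1_eq_three_mul_of_nine_mul {q : ℕ} [NeZero q] (hq : Nat.Coprime 3 q) [IsCyclic (ZMod q)ˣ]
    (hcard : Nat.Coprime 3 (Fintype.card (ZMod q)ˣ)) [NeZero (9 * q)] (D₀ : ModularParametrizationData W₀ (9 * q))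
    (h₀ : ∀ z ∈ D₀.L.lattice, ∃ w ∈ periodLattice D₀.f, z = D₀.c * w) :
    ¬ (∀ z : ℂ, z ∈ periodLatticeGamma1 D₀.f ↔ ∃ w ∈ periodLattice D₀.f, z = 3 * w) := by
  intro hidx
  have hc₀ : (D₀.c : ℂ) ≠ 0 := by exact_mod_cast D₀.maninConstant_ne_zero_holds
  obtain ⟨γ₀, hγ₀⟩ :=
    exists_forall_mem_or_sub_mem_or_add_mem_periodLatticeGamma1_nine_mul_of_isNewform0 hq hcard D₀.f D₀.isNewformOf.1
  set L := D₀.L with hL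
  set s := cuspSymbol D₀.f γ₀ with hs
  -- every `u ∈ Λ₁ = 3Λ₀` has `c₀ u / 3 ∈ Λ_{E₀}`
  have key : ∀ u ∈ periodLatticeGamma1 D₀.f, (D₀.c : ℂ) * u / 3 ∈ L.lattice := by
    intro u hu
    obtain ⟨w, hw, rfl⟩ := (hidx u).mp hu
    have e : (D₀.c : ℂ) * (3 * w) / 3 = (D₀.c : ℂ) * w := by ring
    rw [e]
    exact D₀.smul_periodLattice_le w hw
  have h1 : L.ω₁ / (D₀.c : ℂ) ∈ periodLattice D₀.f := div_maninConstant_mem_periodLattice_of_optimal D₀ h₀ L.ω₁_mem_lattice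
  have h2 : L.ω₂ / (D₀.c : ℂ) ∈ periodLattice D₀.f := div_maninConstant_mem_periodLattice_of_optimal D₀ h₀ L.ω₂_mem_lattice
  -- the four forbidden third-periods
  have nm : ∀ α β : ℚ, ¬ (α.den = 1 ∧ β.den = 1) → (α : ℂ) * L.ω₁ + (β : ℂ) * L.ω₂ ∉ L.lattice :=
    fun α β h hmem ↦ h (PeriodPair.mul_ω₁_add_mul_ω₂_mem_lattice.mp hmem)
  have n1 : L.ω₁ / 3 ∉ L.lattice := by
    have h := nm (1 / 3) 0 (by norm_num); intro hm; apply h; convert hm using 1; push_cast; ring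
  have n2 : L.ω₂ / 3 ∉ L.lattice := by
    have h := nm 0 (1 / 3) (by norm_num); intro hm; apply h; convert hm using 1; push_cast; ring
  have n12 : (L.ω₁ + L.ω₂) / 3 ∉ L.lattice := by
    have h := nm (1 / 3) (1 / 3) (by norm_num); intro hm; apply h; convert hm using 1; push_cast; ring
  have n1m2 : (L.ω₁ - L.ω₂) / 3 ∉ L.lattice := by
    have h := nm (1 / 3) (-(1 / 3)) (by norm_num); intro hm; apply h; convert hm using 1; push_cast; ring
  -- turning a `Λ₁`-membership of a combination of `ω₁/c₀, ω₂/c₀` into a third-period of `Λ_{E₀}`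
  have fin : ∀ {u v : ℂ}, u ∈ periodLatticeGamma1 D₀.f → (D₀.c : ℂ) * u / 3 = v → v ∈ L.lattice :=
    fun hu e ↦ e ▸ key _ hu
  rcases hγ₀ _ h1 with a1 | a1 | a1
  · exact n1 (fin a1 (by field_simp))
  rcases hγ₀ _ h2 with a2 | a2 | a2
  · exact n2 (fin a2 (by field_simp))
  · -- both `≡ s`: the difference
    refine n1m2 (fin (sub_mem a1 a2) ?_)
    rw [hs]; field_simp; ring
  · -- `ω₁/c₀ ≡ s`, `ω₂/c₀ ≡ −s`: the sum
    refine n12 (fin (add_mem a1 a2) ?_)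
    rw [hs]; field_simp; ring
  rcases hγ₀ _ h2 with a2 | a2 | a2
  · exact n2 (fin a2 (by field_simp))
  · -- `ω₁/c₀ ≡ −s`, `ω₂/c₀ ≡ s`: the sum
    refine n12 (fin (add_mem a1 a2) ?_)
    rw [hs]; field_simp; ring
  · -- both `≡ −s`: the difference
    refine n1m2 (fin (sub_mem a1 a2) ?_)
    rw [hs]; field_simp; ring

omit [W₀.IsElliptic] [W₀.IsGloballyMinimal] [NeZero N] in
/-- **At `N = 9p`, `p` a prime `≡ 2 (mod 3)`: no index `9`.** -/
theorem not_periodLatticeGamma1_eq_three_mul_of_nine_mul_prime {p : ℕ} (hp : p.Prime) (hp3 : p % 3 = 2)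
    [NeZero (9 * p)] (D₀ : ModularParametrizationData W₀ (9 * p))
    (h₀ : ∀ z ∈ D₀.L.lattice, ∃ w ∈ periodLattice D₀.f, z = D₀.c * w) :
    ¬ (∀ z : ℂ, z ∈ periodLatticeGamma1 D₀.f ↔ ∃ w ∈ periodLattice D₀.f, z = 3 * w) := by
  haveI : NeZero p := ⟨hp.ne_zero⟩
  haveI : Fact p.Prime := ⟨hp⟩
  haveI : IsCyclic (ZMod p)ˣ := ZMod.isCyclic_units_prime hp
  have h3p : Nat.Coprime 3 p := (Nat.coprime_primes Nat.prime_three hp).2 (by rintro rfl; norm_num at hp3)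
  refine not_periodLatticeGamma1_eq_three_mul_of_nine_mul h3p ?_ D₀ h₀
  rw [ZMod.card_units p]
  have h1 : (p - 1) % 3 = 1 := by have := hp.two_le; omega
  rw [Nat.Coprime, Nat.gcd_rec, h1]
  rfl

/-- **At `N = 9q` (`3 ∤ q`, `(ℤ/q)ˣ` cyclic of order prime to `3`): an optimal curve WITHOUT rational `3`-isogeny is
Stevens' curve** — `Λ₁(f) = Λ₀(f)` and `|c₀| = |c₁|`. -/
theorem stevens_eq_optimal_of_noRationalThreeIsogeny_nine_mul {q : ℕ} [NeZero q] (hq : Nat.Coprime 3 q)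
    [IsCyclic (ZMod q)ˣ] (hcard : Nat.Coprime 3 (Fintype.card (ZMod q)ˣ)) [NeZero (9 * q)]
    (D₁ : Gamma1ParametrizationData W₁ (9 * q)) (D₀ : ModularParametrizationData W₀ (9 * q))
    (hiso : IsIsogenous W₁ W₀) (h₁ : D₁.IsOptimal)
    (h₀ : ∀ z ∈ D₀.L.lattice, ∃ w ∈ periodLattice D₀.f, z = D₀.c * w) (hno : ∀ x : ℚ, W₀.Ψ₃.eval x ≠ 0) :
    periodLatticeGamma1 D₀.f = periodLattice D₀.f ∧ D₀.maninConstant.natAbs = D₁.maninConstant.natAbs := by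
  have hf : D₁.f = D₀.f := D₁.f_eq_of_isIsogenous D₀ hiso
  rcases trichotomy_shimura_of_nine_dvd_level D₁ D₀ hiso h₁ h₀ ⟨q, rfl⟩ with h | h | ⟨x, hx⟩
  · exact ⟨h, natAbs_maninConstant₀_eq_of_periodLatticeGamma1_eq_periodLattice D₁ D₀ h₁ h₀ hf h⟩
  · exact absurd h (not_periodLatticeGamma1_eq_three_mul_of_nine_mul hq hcard D₀ h₀)
  · exact absurd hx (hno x)

/-- **At `N = 9p`, `p` a prime `≡ 2 (mod 3)`**: no rational `3`-isogeny ⟹ `Λ₁(f) = Λ₀(f)` and `|c₀| = |c₁|`. -/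
theorem stevens_eq_optimal_of_noRationalThreeIsogeny_nine_mul_prime {p : ℕ} (hp : p.Prime) (hp3 : p % 3 = 2)
    [NeZero (9 * p)] (D₁ : Gamma1ParametrizationData W₁ (9 * p)) (D₀ : ModularParametrizationData W₀ (9 * p))
    (hiso : IsIsogenous W₁ W₀) (h₁ : D₁.IsOptimal)
    (h₀ : ∀ z ∈ D₀.L.lattice, ∃ w ∈ periodLattice D₀.f, z = D₀.c * w) (hno : ∀ x : ℚ, W₀.Ψ₃.eval x ≠ 0) :
    periodLatticeGamma1 D₀.f = periodLattice D₀.f ∧ D₀.maninConstant.natAbs = D₁.maninConstant.natAbs := by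
  haveI : NeZero p := ⟨hp.ne_zero⟩
  haveI : Fact p.Prime := ⟨hp⟩
  haveI : IsCyclic (ZMod p)ˣ := ZMod.isCyclic_units_prime hp
  have h3p : Nat.Coprime 3 p := (Nat.coprime_primes Nat.prime_three hp).2 (by rintro rfl; norm_num at hp3)
  refine stevens_eq_optimal_of_noRationalThreeIsogeny_nine_mul h3p ?_ D₁ D₀ hiso h₁ h₀ hno
  rw [ZMod.card_units p]
  have h1 : (p - 1) % 3 = 1 := by have := hp.two_le; omega
  rw [Nat.Coprime, Nat.gcd_rec, h1]
  rfl

/-- **DICHOTOMY at `N = 9p`, `p ≡ 2 (mod 3)`**: for the optimal pair of a class, `Λ₁(f) = Λ₀(f)` and `|c₀| = |c₁|`, or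
`W₀` admits a rational `3`-isogeny (`W₀.Ψ₃` has a rational root). -/
theorem periodLatticeGamma1_eq_or_exists_Ψ₃_root_of_nine_mul_prime {p : ℕ} (hp : p.Prime) (hp3 : p % 3 = 2)
    [NeZero (9 * p)] (D₁ : Gamma1ParametrizationData W₁ (9 * p)) (D₀ : ModularParametrizationData W₀ (9 * p))
    (hiso : IsIsogenous W₁ W₀) (h₁ : D₁.IsOptimal)
    (h₀ : ∀ z ∈ D₀.L.lattice, ∃ w ∈ periodLattice D₀.f, z = D₀.c * w) :
    (periodLatticeGamma1 D₀.f = periodLattice D₀.f ∧ D₀.maninConstant.natAbs = D₁.maninConstant.natAbs) ∨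
      ∃ x : ℚ, W₀.Ψ₃.eval x = 0 := by
  by_cases hno : ∃ x : ℚ, W₀.Ψ₃.eval x = 0
  · exact Or.inr hno
  · exact Or.inl (stevens_eq_optimal_of_noRationalThreeIsogeny_nine_mul_prime hp hp3 D₁ D₀ hiso h₁ h₀
      fun x hx ↦ hno ⟨x, hx⟩)

/-- **C3 on the optimal curve ⟺ C3 for Stevens' datum, at `N = 9p` (`p ≡ 2 (mod 3)`) without rational `3`-isogeny**:
`3 ∤ c₀ ⟺ 3 ∤ c₁` (indeed `ℓ ∣ c₀ ⟺ ℓ ∣ c₁` for every `ℓ`). -/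
theorem not_three_dvd_maninConstant₀_iff_of_noRationalThreeIsogeny_nine_mul_prime {p : ℕ} (hp : p.Prime)
    (hp3 : p % 3 = 2) [NeZero (9 * p)] (D₁ : Gamma1ParametrizationData W₁ (9 * p))
    (D₀ : ModularParametrizationData W₀ (9 * p)) (hiso : IsIsogenous W₁ W₀) (h₁ : D₁.IsOptimal)
    (h₀ : ∀ z ∈ D₀.L.lattice, ∃ w ∈ periodLattice D₀.f, z = D₀.c * w) (hno : ∀ x : ℚ, W₀.Ψ₃.eval x ≠ 0) :
    ¬ (3 : ℤ) ∣ D₀.maninConstant ↔ ¬ (3 : ℤ) ∣ D₁.maninConstant := by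
  have heq := (stevens_eq_optimal_of_noRationalThreeIsogeny_nine_mul_prime hp hp3 D₁ D₀ hiso h₁ h₀ hno).2
  rw [← Int.natAbs_dvd_natAbs, ← Int.natAbs_dvd_natAbs (b := D₁.maninConstant), heq]

/-- Divisor form: at `N = 9p` (`p ≡ 2 (mod 3)`), without rational `3`-isogeny, `ℓ ∣ c₀ ⟺ ℓ ∣ c₁` for every integer `ℓ`. -/
theorem dvd_maninConstant₀_iff_of_noRationalThreeIsogeny_nine_mul_prime {p : ℕ} (hp : p.Prime) (hp3 : p % 3 = 2)
    [NeZero (9 * p)] (D₁ : Gamma1ParametrizationData W₁ (9 * p)) (D₀ : ModularParametrizationData W₀ (9 * p))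
    (hiso : IsIsogenous W₁ W₀) (h₁ : D₁.IsOptimal)
    (h₀ : ∀ z ∈ D₀.L.lattice, ∃ w ∈ periodLattice D₀.f, z = D₀.c * w) (hno : ∀ x : ℚ, W₀.Ψ₃.eval x ≠ 0) (ℓ : ℤ) :
    ℓ ∣ D₀.maninConstant ↔ ℓ ∣ D₁.maninConstant := by
  have heq := (stevens_eq_optimal_of_noRationalThreeIsogeny_nine_mul_prime hp hp3 D₁ D₀ hiso h₁ h₀ hno).2
  rw [← Int.natAbs_dvd_natAbs, ← Int.natAbs_dvd_natAbs (b := D₁.maninConstant), heq]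

end Summit.BirchSwinnertonDyer.BirchSwinnertonDyer.Theorems.ManinLocalTwoThree

end
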